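import Summits.CriticalPhenomena.PercolationContinuityZ3.Theorems.PercNearOneGluingNoHeavyLowerTailSahiLatinTerminalSupport

/-!
# `NoHeavyLowerTail` (crux stmt-CriticalPhenomena-4575), Sahi programme (prim-master-conj gen 44): the PAIR FORM TZ″ of the zero-locus conjecture —
# mutually A-closed dependent pairs admit no nontrivial zero (typed conjecture; TZ″ ⟹ TZ′ ⟹ TZ proved), every dimension

Support file (`--supports stmt-CriticalPhenomena-4575`; companion of `…SahiLatinTerminalSupport`).  Memo
`run/shared/lean/prim/prim-l12/FROM-prim-master-conj-g44-SLACK-CALCULUS.md` §5; POINTWISE §45 (V7b).  TZ″ is a typed `Prop`, NEVER asserted; the implications are proved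
(standard axioms, no FBP).

A pair of subsets `(b, c)` of `[3]^ι` is MUTUALLY A-CLOSED (`MutAClosed b c`) if every maximal non-element of `b` lies in `c` and every maximal non-element of `c` lies in
`b`; each pair of an A-closed triple is mutually A-closed (`AClosed.mutAClosed₂₃` etc.).
* CONJECTURE TZ″ (`MutAClosedZeroFree ι`): for proper up-sets `b, c` that are mutually A-closed and NOT independent, `κ(a,b,c) ≠ 0` for every nonempty up-set `a`
  (equivalently, by FBP, `> 0`; no condition on `a`).  Evidence: `d = 2, 3` exhaustive (d = 3: 11 048 ordered pairs, the maximal zero is empty for all, margin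
  `min_{a ≠ ∅} κ ≥ 2`), `d = 4, 5, 6` by min-cut over all `a` at once (33 316 / 2 436 / 129 pairs, no exception).
* `aclosedZerosIndep_of_mutAClosedZeroFree`: **TZ″ ⟹ TZ′**, hence `⟹ TZ` — at an A-closed zero with nonempty proper slots each pair is mutually A-closed and the third
  slot is a nonempty zero-partner, so each pair is independent.
HONEST LABEL: TZ″, TZ′, TZ, FBP (`d ≥ 5`) are OPEN.
-/

namespace Summit.CriticalPhenomena.PercolationContinuityZ3.Theorems.SahiLatin

open Finset

variable {ι : Type*} [Fintype ι] [DecidableEq ι]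

/-- A MUTUALLY A-CLOSED pair: every maximal non-element of `b` lies in `c` and vice versa. [this work] -/
def MutAClosed (b c : Finset (Pt ι)) : Prop := (∀ m, IsMaxOut b m → m ∈ c) ∧ (∀ m, IsMaxOut c m → m ∈ b)

omit [Fintype ι] [DecidableEq ι] in
/-- Mutual A-closedness is symmetric. [this work] -/
theorem MutAClosed.symm {b c : Finset (Pt ι)} (h : MutAClosed b c) : MutAClosed c b := ⟨h.2, h.1⟩

omit [Fintype ι] [DecidableEq ι] in
/-- In an A-closed triple the pair `(b, c)` is mutually A-closed. [this work] -/
theorem AClosed.mutAClosed₂₃ {a b c : Finset (Pt ι)} (h : AClosed a b c) : MutAClosed b c :=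
  ⟨fun m hm => (h.c2b m hm).2, fun m hm => (h.c2c m hm).2⟩

omit [Fintype ι] [DecidableEq ι] in
/-- In an A-closed triple the pair `(a, c)` is mutually A-closed. [this work] -/
theorem AClosed.mutAClosed₁₃ {a b c : Finset (Pt ι)} (h : AClosed a b c) : MutAClosed a c :=
  ⟨fun m hm => (h.c2a m hm).2, fun m hm => (h.c2c m hm).1⟩

omit [Fintype ι] [DecidableEq ι] in
/-- In an A-closed triple the pair `(a, b)` is mutually A-closed. [this work] -/
theorem AClosed.mutAClosed₁₂ {a b c : Finset (Pt ι)} (h : AClosed a b c) : MutAClosed a b :=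
  ⟨fun m hm => (h.c2a m hm).1, fun m hm => (h.c2b m hm).1⟩

/-- At a mutually A-closed pair of up-sets `ess(b ∩ c) = ess(b) ∪ ess(c)` (the support lemma needs nothing else). [this work] -/
theorem MutAClosed.axisInessential_inter_iff {b c : Finset (Pt ι)} (hb : IsUpperSet (b : Set (Pt ι))) (hc : IsUpperSet (c : Set (Pt ι)))
    (h : MutAClosed b c) (i : ι) : AxisInessential (b ∩ c) i ↔ AxisInessential b i ∧ AxisInessential c i :=
  axisInessential_inter_iff_of_C2 hb hc h.2 h.1 i

/-- **CONJECTURE TZ″** (prim-master-conj gen 44; typed, NEVER asserted): if `b, c` are proper up-sets of `[3]^ι`, mutually A-closed and NOT independent, then no nonempty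
up-set `a` gives a zero: `κ(a,b,c) ≠ 0`.  Exhaustive for `d ≤ 3`, min-cut-sampled for `d = 4, 5, 6`.  An obligation / hypothesis, never a fact. [this work] [status: open] -/
@[conjecture] def MutAClosedZeroFree (ι : Type*) [Fintype ι] [DecidableEq ι] : Prop :=
  ∀ a b c : Finset (Pt ι), UpTriple a b c → a.Nonempty → b.Nonempty → b ≠ univ → c.Nonempty → c ≠ univ → MutAClosed b c → ¬ Indep b c →
    kappa a b c ≠ 0

/-- TZ″ in positive form: a nonempty zero-partner of a mutually A-closed pair of proper up-sets forces the pair to be independent. [this work] -/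
theorem indep_of_mutAClosed_zero (h : MutAClosedZeroFree ι) {a b c : Finset (Pt ι)} (hup : UpTriple a b c) (ha : a.Nonempty)
    (hb : b.Nonempty) (hb' : b ≠ univ) (hc : c.Nonempty) (hc' : c ≠ univ) (hM : MutAClosed b c) (h0 : kappa a b c = 0) : Indep b c := by
  by_contra hne
  exact h a b c hup ha hb hb' hc hc' hM hne h0

/-- **TZ″ ⟹ TZ′**: under TZ″ every A-closed zero with nonempty proper slots is pairwise independent. [this work] -/
theorem aclosedZerosIndep_of_mutAClosedZeroFree (h : MutAClosedZeroFree ι) : AClosedZerosIndep ι := by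
  intro a b c hup ha ha' hb hb' hc hc' hA h0
  have hbc : Indep b c := indep_of_mutAClosed_zero h hup ha hb hb' hc hc' hA.mutAClosed₂₃ h0
  have hac : Indep a c := by
    have h0' : kappa b a c = 0 := by rw [← kappa_swap12]; exact h0
    exact indep_of_mutAClosed_zero h hup.swap12 hb ha ha' hc hc' hA.mutAClosed₁₃ h0'
  have hab : Indep a b := by
    have h0' : kappa c a b = 0 := by rw [kappa_swap12, kappa_swap23]; exact h0
    exact indep_of_mutAClosed_zero h (hup.swap23.swap12) hc ha ha' hb hb' hA.mutAClosed₁₂ h0'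
  exact ⟨hab, hac, hbc⟩

/-- **TZ″ ⟹ TZ.** [this work] -/
theorem terminalZerosIndep_of_mutAClosedZeroFree (h : MutAClosedZeroFree ι) : TerminalZerosIndep ι :=
  terminalZerosIndep_of_aclosedZerosIndep (aclosedZerosIndep_of_mutAClosedZeroFree h)

end Summit.CriticalPhenomena.PercolationContinuityZ3.Theorems.SahiLatin
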